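import Literature.Analysis.FluidPDE.OseenDuhamelEnergyBound
import Literature.Analysis.FluidPDE.KatoBilinearEstimates
import Literature.Analysis.UnboundedOperators.HeatKernelLpSmoothingProofs
import HarnessLib

/-!
# Kato's a-priori bound for bounded classical solutions of the FORCED Navier–Stokes system on `ℝ³`
# with scale-invariantly small data (Kato 1984, Thm. 2 / (2.3)–(2.5); Lemarié-Rieusset 2016, Thm. 15.2)

Analysis/FluidPDE proof file (cell `pub/ns-blowup`, seat `ns-blowup-lit` g12; theorems only, no
definitions, no named facts). It is the a-priori half of the discharge of the cell's typed hypothesis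
`SmallDataClassicalEngine ν` (`Summits/NavierStokesRegularity/FluidComputer/PalasekTowerRegisterGlobalSmallData.lean`,
Kato's small-data theory WITH a confined Clay-class force, classical output). WHAT THIS IS NOT: not a
statement about Navier–Stokes regularity or blow-up — a bound for GIVEN bounded classical solutions
whose data are small in Kato's scale-invariant sense.

**Setting.** `(u, p)` is a classical solution of the Navier–Stokes system on the closed slab
`[0, T] × ℝ³` (`ν > 0`) driven by a jointly continuous force `g` with bounded, weakly divergence-free,
uniformly square-integrable slices `‖g(τ)‖_{L²} ≤ G₂` (the Leray projection `P f` of a Clay-class force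
`f` is of this kind), with finite energy and bounded velocity; such a solution obeys the forced Oseen
representation `u(t) = e^{νtΔ}u(0) - B^ν_0(u,u)(t) + ∫₀ᵗ e^{ν(t-τ)Δ} g(τ) dτ`
(`IsClassicalNSSolutionOn.ae_eq_forced_oseenMild`, Lemarié-Rieusset 2016, Thm. 6.1 with Prop. 6.5).

**Statement** (`kato_apriori_forced`). There are absolute constants `ε₀ > 0` and `K` such that, with the
DIMENSIONLESS SIZE `δ := ‖u(0)‖_{L³}/ν + T^{3/4} G₂ / ν^{5/4}` of the data, IF `δ ≤ ε₀` THEN for all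
`t ∈ (0, T]`
`‖u(t)‖_{L⁶} ≤ K δ ν^{3/4} t^{-1/4}` and `sup_x |u(t, x)| ≤ K δ ν^{1/2} t^{-1/2}`
— Kato's weighted classes `t^{1/4}L⁶ ∩ t^{1/2}L^∞` (Kato 1984, Thm. 2 with (2.3)–(2.5), `m = 3`,
`q = 6`; Lemarié-Rieusset 2016, Thm. 15.2 (the Kato theorem) and Thm. 7.5). The force enters only through
the `L²` size of its slices: `‖∫₀ᵗ e^{ν(t-τ)Δ} g‖_{L⁶} ≤ C ν^{-1/2} G₂ t^{1/2}` and
`|∫₀ᵗ e^{ν(t-τ)Δ} g (x)| ≤ C ν^{-3/4} G₂ t^{1/4}` (heat `L² → L⁶`, `L² → L^∞`), both of weight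
`T^{3/4} G₂ ν^{-5/4}` in Kato's dimensionless norms.

**Proof** (Kato's, run as an a-priori estimate on the classical solution instead of a fixed point):
with `Φ₆(s) := s^{1/4} ν^{-3/4} ‖u(s)‖₆`, the representation, the heat bounds `L³ → L⁶`, `L² → L⁶`
and Kato's `L⁶` estimate of the Oseen–Duhamel term (`exists_eLpNorm_six_oseenDuhamel_le`, which only
sees the `L⁶` weights) give `Φ₆(s) ≤ C δ + c (sup_{τ<s} Φ₆(τ))²`; `Φ₆` is continuous on `[0, T]` with
`Φ₆(0) = 0` (hypothesis: `s ↦ ‖u(s)‖₆` is continuous — true in Tao's class), so the quadratic bootstrap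
closes at `Φ₆ ≤ 2Cδ` for `δ` small (first-bad-time argument). The sup bound is then LINEAR: Kato's
pointwise estimate (`exists_norm_oseenDuhamel_le`) gives
`√s |u(s,x)| ≤ C δ √ν + c (2Cδ) sup_{τ≤s} √τ ‖u(τ)‖_∞`, and `c (2Cδ) ≤ 1/4` absorbs.

## Mathlib / tree search

Tree (reused by name): `IsClassicalNSSolutionOn.ae_eq_forced_oseenMild`, `forceDuhamel`,
`stronglyMeasurable_forceDuhamelIntegrand_swap`, `aestronglyMeasurable_forceDuhamel`
(`ForcedOseenRepresentation(Classical)`); `exists_eLpNorm_six_oseenDuhamel_le`,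
`exists_norm_oseenDuhamel_le`, `lintegral_Ioo_ofReal_sub_rpow_mul_rpow`,
`setIntegral_Ioo_sub_rpow_mul_rpow` (`KatoBilinearEstimates`);
`UnboundedOperators.eLpNorm_heatExtension_le_rpow_holds`, `eLpNorm_top_heatExtension_le_of_Lr`,
`norm_heatExtension_le_of_eLpNorm_two`, `forall_norm_le_of_ae_norm_le`;
`FunctionSpaces.eLpNorm_integral_le_lintegral_eLpNorm` (Minkowski). `lean search 'kato.*apriori|
apriori.*kato|forced.*Kato'`: nothing for the forced classical a-priori form (the tree's Kato files
build mild solutions by fixed point: `KatoPicard`, `KatoWeightedDuhamel`, `kato_local_L3`,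
`kato_global_small_holds` — unforced).

## References

* T. Kato, *Strong `L^p`-solutions of the Navier–Stokes equation in `ℝ^m`, with applications to weak
  solutions*, Math. Z. 187 (1984) 471–480, Thm. 2 and (2.3)–(2.5). [Kato1984]
* P. G. Lemarié-Rieusset, *The Navier–Stokes Problem in the 21st Century*, CRC Press (2016), Thm. 7.5
  (proof, (7.40)), Thm. 15.2, Thm. 6.1 with Prop. 6.5. [LemarieRieusset2016]
-/

noncomputable section

open MeasureTheory TopologicalSpace Set Function Filter
open _root_.Topology
open scoped InnerProductSpace RealInnerProductSpace ENNReal NNReal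

namespace Literature.Analysis.FluidPDE

namespace KatoAprioriForced

/-! ### Small tools -/

/-- `dim ℝ³ = 3` in the exact syntactic form consumed by the Kato estimates. [folklore] -/
private theorem finrank_three : Module.finrank ℝ (EuclideanSpace ℝ (Fin 3)) = 3 := by
  rw [finrank_euclideanSpace, Fintype.card_fin]

/-- `L² ∩ L^∞ ⊂ L^r`, `r ≥ 2`: `∫ ‖f‖^r ≤ M^{r-2} ∫ ‖f‖²` for a field bounded by `M`. [folklore] -/
private theorem lintegral_rpow_enorm_le_of_norm_le' {f : EuclideanSpace ℝ (Fin 3) → EuclideanSpace ℝ (Fin 3)}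
    {M : ℝ} (hf : ∀ x, ‖f x‖ ≤ M) {r : ℝ} (hr : 2 ≤ r) :
    ∫⁻ x, ‖f x‖ₑ ^ r ≤ ENNReal.ofReal M ^ (r - 2) * ∫⁻ x, ‖f x‖ₑ ^ (2 : ℝ) := by
  rw [← lintegral_const_mul' _ _ (ENNReal.rpow_ne_top_of_nonneg (by linarith) ENNReal.ofReal_ne_top)]
  refine lintegral_mono fun x => ?_
  have hsplit : ‖f x‖ₑ ^ r = ‖f x‖ₑ ^ (r - 2) * ‖f x‖ₑ ^ (2 : ℝ) := by
    rw [← ENNReal.rpow_add_of_nonneg (r - 2) 2 (by linarith) (by norm_num)]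
    ring_nf
  rw [hsplit]
  gcongr
  rw [← ofReal_norm]
  exact ENNReal.ofReal_le_ofReal (hf x)

/-- A bounded square-integrable (measurable) field has finite `L^r` norm for `2 ≤ r < ∞`. [folklore] -/
private theorem eLpNorm_lt_top_of_norm_le_of_sq {f : EuclideanSpace ℝ (Fin 3) → EuclideanSpace ℝ (Fin 3)}
    {M : ℝ} (hf : ∀ x, ‖f x‖ ≤ M) (h2 : ∫⁻ x, ‖f x‖ₑ ^ 2 < ⊤) {r : ℝ} (hr : 2 ≤ r) :
    eLpNorm f (ENNReal.ofReal r) volume < ⊤ := by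
  have hr0 : 0 < r := by linarith
  have hp0 : ENNReal.ofReal r ≠ 0 := (ENNReal.ofReal_pos.2 hr0).ne'
  rw [eLpNorm_eq_lintegral_rpow_enorm_toReal hp0 ENNReal.ofReal_ne_top, ENNReal.toReal_ofReal hr0.le]
  refine ENNReal.rpow_lt_top_of_nonneg (by positivity) (ne_of_lt ?_)
  refine (lintegral_rpow_enorm_le_of_norm_le' hf hr).trans_lt ?_
  have h2' : ∫⁻ x, ‖f x‖ₑ ^ (2 : ℝ) < ⊤ := by
    refine lt_of_le_of_lt (le_of_eq (lintegral_congr fun x => ?_)) h2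
    rw [← ENNReal.rpow_natCast]; norm_num
  exact ENNReal.mul_lt_top (ENNReal.rpow_lt_top_of_nonneg (by linarith) ENNReal.ofReal_ne_top) h2'

/-- The toReal exponents of the heat smoothing `L³ → L⁶` and `L² → L⁶` on `ℝ³`. [folklore] -/
private theorem heat_exponents :
    -((Module.finrank ℝ (EuclideanSpace ℝ (Fin 3)) : ℝ) / 2) *
        ((1 / (3 : ℝ≥0∞)).toReal - (1 / (6 : ℝ≥0∞)).toReal) = -(1 / 4 : ℝ) ∧
      -((Module.finrank ℝ (EuclideanSpace ℝ (Fin 3)) : ℝ) / 2) *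
        ((1 / (2 : ℝ≥0∞)).toReal - (1 / (6 : ℝ≥0∞)).toReal) = -(1 / 2 : ℝ) := by
  rw [finrank_three]
  simp only [one_div, ENNReal.toReal_inv, ENNReal.toReal_ofNat]
  norm_num

/-- **Heat smoothing `L³ → L⁶` on `ℝ³`**: `‖e^{tΔ}f‖₆ ≤ C t^{-1/4} ‖f‖₃`. [cite: GigaGigaSaal2010, §1.1.3] -/
theorem exists_eLpNorm_six_heatExtension_le_of_three :
    ∃ C : ℝ≥0, ∀ f : EuclideanSpace ℝ (Fin 3) → EuclideanSpace ℝ (Fin 3), MemLp f 3 volume →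
      ∀ t : ℝ, 0 < t → eLpNorm (UnboundedOperators.heatExtension f t) 6 volume ≤
        (C : ℝ≥0∞) * ENNReal.ofReal (t ^ (-(1 / 4 : ℝ))) * eLpNorm f 3 volume := by
  obtain ⟨C, hC⟩ := UnboundedOperators.eLpNorm_heatExtension_le_rpow_holds
    (E := EuclideanSpace ℝ (Fin 3)) (F := EuclideanSpace ℝ (Fin 3)) (p := 3) (q := 6)
    (by norm_num) (by norm_num)
  refine ⟨C, fun f hf t ht => ?_⟩
  have h := hC f hf t ht
  rwa [heat_exponents.1] at h

/-- **Heat smoothing `L² → L⁶` on `ℝ³`**: `‖e^{tΔ}f‖₆ ≤ C t^{-1/2} ‖f‖₂`. [cite: GigaGigaSaal2010, §1.1.3] -/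
theorem exists_eLpNorm_six_heatExtension_le_of_two :
    ∃ C : ℝ≥0, ∀ f : EuclideanSpace ℝ (Fin 3) → EuclideanSpace ℝ (Fin 3), MemLp f 2 volume →
      ∀ t : ℝ, 0 < t → eLpNorm (UnboundedOperators.heatExtension f t) 6 volume ≤
        (C : ℝ≥0∞) * ENNReal.ofReal (t ^ (-(1 / 2 : ℝ))) * eLpNorm f 2 volume := by
  obtain ⟨C, hC⟩ := UnboundedOperators.eLpNorm_heatExtension_le_rpow_holds
    (E := EuclideanSpace ℝ (Fin 3)) (F := EuclideanSpace ℝ (Fin 3)) (p := 2) (q := 6)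
    (by norm_num) (by norm_num)
  refine ⟨C, fun f hf t ht => ?_⟩
  have h := hC f hf t ht
  rwa [heat_exponents.2] at h

/-! ### The force term `∫₀ᵗ e^{ν(t-τ)Δ} g(τ) dτ` of an `L²`-bounded force -/

section Force

variable {ν t G₂ : ℝ} {g : ℝ → EuclideanSpace ℝ (Fin 3) → EuclideanSpace ℝ (Fin 3)}

/-- Slices of a jointly continuous force with `‖g(τ)‖₂ ≤ G₂` are in `L²`. [folklore] -/
private theorem memLp_two_slice (hgc : Continuous (uncurry g)) {τ : ℝ}
    (hg2 : eLpNorm (g τ) 2 volume ≤ ENNReal.ofReal G₂) :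
    MemLp (g τ) 2 volume :=
  ⟨(hgc.comp (continuous_const.prodMk continuous_id)).aestronglyMeasurable,
    hg2.trans_lt ENNReal.ofReal_lt_top⟩

/-- **`L⁶` size of the force term**: `‖∫₀ᵗ e^{ν(t-τ)Δ} g(τ) dτ‖_{L⁶} ≤ C ν^{-1/2} G₂ t^{1/2}` when
`‖g(τ)‖₂ ≤ G₂` on `(0, t)` (Minkowski's integral inequality, heat `L² → L⁶` with rate
`(ν(t-τ))^{-1/2}`, `∫₀ᵗ (t-τ)^{-1/2} dτ = 2√t`). [cite: LemarieRieusset2016, Thm. 15.2 (proof: the force term of (6.12))] -/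
theorem exists_eLpNorm_six_forceDuhamel_le :
    ∃ C : ℝ, 0 ≤ C ∧ ∀ {ν t G₂ : ℝ} {g : ℝ → EuclideanSpace ℝ (Fin 3) → EuclideanSpace ℝ (Fin 3)},
      0 < ν → 0 < t → Continuous (uncurry g) → 0 ≤ G₂ →
      (∀ τ ∈ Ioo 0 t, eLpNorm (g τ) 2 volume ≤ ENNReal.ofReal G₂) →
        eLpNorm (forceDuhamel ν 0 g t) 6 volume ≤
          ENNReal.ofReal (C * ν ^ (-(1 / 2 : ℝ)) * G₂ * t ^ (1 / 2 : ℝ)) := by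
  obtain ⟨C, hC⟩ := exists_eLpNorm_six_heatExtension_le_of_two
  set I : ℝ := ∫ s in (0 : ℝ)..1, (1 - s) ^ (-(1 / 2 : ℝ)) * s ^ (-(0 : ℝ)) with hI
  have hI0 : 0 ≤ I := integral_one_sub_rpow_mul_rpow_nonneg _ _
  refine ⟨C * I, by positivity, fun {ν t G₂ g} hν ht hgc hG₂ hg2 => ?_⟩
  have hgm : StronglyMeasurable (uncurry g) := hgc.stronglyMeasurable
  -- Minkowski in `τ`
  set F : EuclideanSpace ℝ (Fin 3) → ℝ → EuclideanSpace ℝ (Fin 3) := fun x τ =>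
    UnboundedOperators.heatExtension (g τ) (ν * (t - τ)) x with hFdef
  have hFm : AEStronglyMeasurable (uncurry F)
      ((volume : Measure (EuclideanSpace ℝ (Fin 3))).prod ((volume : Measure ℝ).restrict (Ioo 0 t))) :=
    (stronglyMeasurable_forceDuhamelIntegrand_swap hgm ν t).aestronglyMeasurable
  have hMink := FunctionSpaces.eLpNorm_integral_le_lintegral_eLpNorm
    (μ := (volume : Measure (EuclideanSpace ℝ (Fin 3)))) (ν := (volume : Measure ℝ).restrict (Ioo 0 t))
    hFm (p := 6) (by norm_num) (by norm_num)
  have hfd : forceDuhamel ν 0 g t = fun x => ∫ τ in Ioo 0 t, F x τ := by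
    funext x; rw [forceDuhamel_apply]
  -- the slice bound
  have hslice : ∀ τ ∈ Ioo 0 t, eLpNorm (fun x => F x τ) 6 volume ≤
      ENNReal.ofReal (C * ν ^ (-(1 / 2 : ℝ)) * G₂ * ((t - τ) ^ (-(1 / 2 : ℝ)) * τ ^ (-(0 : ℝ)))) := by
    intro τ hτ
    have hστ : 0 < t - τ := sub_pos.2 hτ.2
    have hσ : 0 < ν * (t - τ) := mul_pos hν hστ
    have h1 := hC (g τ) (memLp_two_slice hgc (hg2 τ hτ)) (ν * (t - τ)) hσ
    refine h1.trans ?_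
    calc (C : ℝ≥0∞) * ENNReal.ofReal ((ν * (t - τ)) ^ (-(1 / 2 : ℝ))) * eLpNorm (g τ) 2 volume
        ≤ (C : ℝ≥0∞) * ENNReal.ofReal ((ν * (t - τ)) ^ (-(1 / 2 : ℝ))) * ENNReal.ofReal G₂ := by
          gcongr; exact hg2 τ hτ
      _ = ENNReal.ofReal (C * ν ^ (-(1 / 2 : ℝ)) * G₂ * ((t - τ) ^ (-(1 / 2 : ℝ)) * τ ^ (-(0 : ℝ)))) := by
          rw [neg_zero, Real.rpow_zero, mul_one, ENNReal.coe_nnreal_eq, ← ENNReal.ofReal_mul NNReal.zero_le_coe,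
            ← ENNReal.ofReal_mul (by positivity), Real.mul_rpow hν.le hστ.le]
          congr 1; ring
  calc eLpNorm (forceDuhamel ν 0 g t) 6 volume
      = eLpNorm (fun x => ∫ τ in Ioo 0 t, F x τ) 6 volume := by rw [hfd]
    _ ≤ ∫⁻ τ in Ioo 0 t, eLpNorm (fun x => F x τ) 6 volume := hMink
    _ ≤ ∫⁻ τ in Ioo 0 t, ENNReal.ofReal (C * ν ^ (-(1 / 2 : ℝ)) * G₂ *
          ((t - τ) ^ (-(1 / 2 : ℝ)) * τ ^ (-(0 : ℝ)))) :=
        setLIntegral_mono' measurableSet_Ioo fun τ hτ => hslice τ hτ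
    _ = ENNReal.ofReal (C * ν ^ (-(1 / 2 : ℝ)) * G₂ * (t ^ (1 - 1 / 2 - 0 : ℝ) * I)) :=
        lintegral_Ioo_ofReal_sub_rpow_mul_rpow (by norm_num) (by norm_num) le_rfl (by norm_num)
          (by positivity) ht
    _ = ENNReal.ofReal (C * I * ν ^ (-(1 / 2 : ℝ)) * G₂ * t ^ (1 / 2 : ℝ)) := by
        rw [show (1 - 1 / 2 - 0 : ℝ) = 1 / 2 by norm_num]; ring_nf

/-- **Pointwise size of the force term**: `|∫₀ᵗ e^{ν(t-τ)Δ} g(τ) dτ (x)| ≤ C ν^{-3/4} G₂ t^{1/4}` for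
EVERY `x`, when `‖g(τ)‖₂ ≤ G₂` on `(0, t)` (heat `L² → L^∞` at every point with rate `σ^{-3/4}`,
`∫₀ᵗ (t-τ)^{-3/4} dτ = 4 t^{1/4}`). [cite: LemarieRieusset2016, Thm. 15.2 (proof: the force term of (6.12))] -/
theorem exists_norm_forceDuhamel_le_of_eLpNorm_two :
    ∃ C : ℝ, 0 ≤ C ∧ ∀ {ν t G₂ : ℝ} {g : ℝ → EuclideanSpace ℝ (Fin 3) → EuclideanSpace ℝ (Fin 3)},
      0 < ν → 0 < t → Continuous (uncurry g) → 0 ≤ G₂ →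
      (∀ τ ∈ Ioo 0 t, eLpNorm (g τ) 2 volume ≤ ENNReal.ofReal G₂) →
        ∀ x, ‖forceDuhamel ν 0 g t x‖ ≤ C * ν ^ (-(3 / 4 : ℝ)) * G₂ * t ^ (1 / 4 : ℝ) := by
  set I : ℝ := ∫ s in (0 : ℝ)..1, (1 - s) ^ (-(3 / 4 : ℝ)) * s ^ (-(0 : ℝ)) with hI
  have hI0 : 0 ≤ I := integral_one_sub_rpow_mul_rpow_nonneg _ _
  refine ⟨I, hI0, fun {ν t G₂ g} hν ht hgc hG₂ hg2 x => ?_⟩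
  -- the integrable majorant `b(τ) = G₂ ν^{-3/4} (t-τ)^{-3/4}`
  set b : ℝ → ℝ := fun τ => ν ^ (-(3 / 4 : ℝ)) * G₂ * ((t - τ) ^ (-(3 / 4 : ℝ)) * τ ^ (-(0 : ℝ))) with hb
  have hbint : IntegrableOn b (Ioo 0 t) volume := by
    have h := (intervalIntegrable_sub_rpow_mul_rpow (a := 3 / 4) (b := 0) (by norm_num)
      (by norm_num) le_rfl (by norm_num) ht).const_mul (ν ^ (-(3 / 4 : ℝ)) * G₂)
    rw [intervalIntegrable_iff_integrableOn_Ioo_of_le ht.le] at h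
    exact h
  have hle : ∀ τ ∈ Ioo 0 t, ‖UnboundedOperators.heatExtension (g τ) (ν * (t - τ)) x‖ ≤ b τ := by
    intro τ hτ
    have hστ : 0 < t - τ := sub_pos.2 hτ.2
    have hσ : 0 < ν * (t - τ) := mul_pos hν hστ
    have h1 := norm_heatExtension_le_of_eLpNorm_two (memLp_two_slice hgc (hg2 τ hτ)) hG₂ (hg2 τ hτ) hσ x
    refine h1.trans (le_of_eq ?_)
    simp only [hb, neg_zero, Real.rpow_zero, mul_one]
    rw [Real.mul_rpow hν.le hστ.le]
    ring
  have hae : ∀ᵐ τ ∂((volume : Measure ℝ).restrict (Ioo 0 t)),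
      ‖UnboundedOperators.heatExtension (g τ) (ν * (t - τ)) x‖ ≤ b τ :=
    (ae_restrict_iff' measurableSet_Ioo).2 (Eventually.of_forall hle)
  rw [forceDuhamel_apply]
  calc ‖∫ τ in Ioo 0 t, UnboundedOperators.heatExtension (g τ) (ν * (t - τ)) x‖
      ≤ ∫ τ in Ioo 0 t, b τ := norm_integral_le_of_norm_le hbint hae
    _ = ν ^ (-(3 / 4 : ℝ)) * G₂ * (t ^ (1 - 3 / 4 - 0 : ℝ) * I) := by
        rw [hb, integral_const_mul, setIntegral_Ioo_sub_rpow_mul_rpow ht]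
    _ = I * ν ^ (-(3 / 4 : ℝ)) * G₂ * t ^ (1 / 4 : ℝ) := by
        rw [show (1 - 3 / 4 - 0 : ℝ) = 1 / 4 by norm_num]; ring

end Force

/-! ### The slices of a bounded classical solution: regularity bookkeeping -/

section Slices

variable {ν T M G G₂ : ℝ} {g u : ℝ → EuclideanSpace ℝ (Fin 3) → EuclideanSpace ℝ (Fin 3)}
  {p : ℝ → EuclideanSpace ℝ (Fin 3) → ℝ}

/-- The slices of a classical solution on `[0, T]` are continuous. [folklore] -/
private theorem continuous_slice (hcl : IsClassicalNSSolutionOn (Icc 0 T) ν g u p) {τ : ℝ}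
    (hτ : τ ∈ Icc 0 T) : Continuous (u τ) :=
  (hcl.contDiff_velocity hτ).continuous

/-- The clamped field `ũ(τ) = u(proj_{[0,T]} τ)` is jointly continuous, hence jointly measurable
(the Kato estimates ask for a globally measurable space–time field; `ũ = u` on `[0, T]`). [folklore] -/
private theorem measurable_uncurry_clamp (hcl : IsClassicalNSSolutionOn (Icc 0 T) ν g u p)
    (hT : 0 < T) :
    Measurable (uncurry fun τ y => u (Set.projIcc 0 T hT.le τ : ℝ) y) := by
  have hcont : ContinuousOn (uncurry u) (Icc 0 T ×ˢ univ) := hcl.smooth_velocity.continuousOn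
  have hφ : Continuous fun q : ℝ × EuclideanSpace ℝ (Fin 3) =>
      ((Set.projIcc 0 T hT.le q.1 : ℝ), q.2) :=
    (continuous_subtype_val.comp (continuous_projIcc.comp continuous_fst)).prodMk continuous_snd
  have hmaps : ∀ q : ℝ × EuclideanSpace ℝ (Fin 3),
      ((Set.projIcc 0 T hT.le q.1 : ℝ), q.2) ∈ Icc 0 T ×ˢ (univ : Set (EuclideanSpace ℝ (Fin 3))) :=
    fun q => ⟨(Set.projIcc 0 T hT.le q.1).2, mem_univ _⟩
  have h : Continuous ((uncurry u) ∘ fun q : ℝ × EuclideanSpace ℝ (Fin 3) =>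
      ((Set.projIcc 0 T hT.le q.1 : ℝ), q.2)) := hcont.comp_continuous hφ hmaps
  exact h.measurable

/-- On `[0, T]` the clamp is the identity. [folklore] -/
private theorem projIcc_val_of_mem (hT : 0 < T) {τ : ℝ} (hτ : τ ∈ Icc 0 T) :
    (Set.projIcc 0 T hT.le τ : ℝ) = τ := by
  rw [Set.projIcc_of_mem hT.le hτ]

/-- The Oseen–Duhamel term only sees `u` on `(0, s) ⊆ [0, T]`: it agrees with that of the clamped
field. [folklore] -/
private theorem oseenDuhamel_clamp_eq (hT : 0 < T) {s : ℝ} (hs : s ∈ Ioc 0 T)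
    (x : EuclideanSpace ℝ (Fin 3)) :
    oseenDuhamel ν 0 (fun τ y => u (Set.projIcc 0 T hT.le τ : ℝ) y)
        (fun τ y => u (Set.projIcc 0 T hT.le τ : ℝ) y) s x = oseenDuhamel ν 0 u u s x := by
  rw [oseenDuhamel_apply, oseenDuhamel_apply]
  refine setIntegral_congr_fun measurableSet_Ioo fun τ hτ => ?_
  have hτI : τ ∈ Icc 0 T := ⟨hτ.1.le, hτ.2.le.trans hs.2⟩
  simp only [projIcc_val_of_mem hT hτI]

/-- `u(0) ∈ L³` with `‖u(0)‖₃ = a := (‖u(0)‖₃).toReal` finite, for a bounded finite-energy slice. [folklore] -/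
private theorem eLpNorm_three_slice_lt_top (hcl : IsClassicalNSSolutionOn (Icc 0 T) ν g u p)
    (hT : 0 < T) (hE : ∃ C : ℝ≥0∞, C < ⊤ ∧ ∀ t ∈ Icc 0 T, ∫⁻ x, ‖u t x‖ₑ ^ 2 ≤ C)
    (hMb : ∀ t ∈ Icc 0 T, ∀ y, ‖u t y‖ ≤ M) {τ : ℝ} (hτ : τ ∈ Icc 0 T) {r : ℝ} (hr : 2 ≤ r) :
    eLpNorm (u τ) (ENNReal.ofReal r) volume < ⊤ := by
  obtain ⟨C, hC, hCb⟩ := hE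
  have _ := hcl; have _ := hT
  exact eLpNorm_lt_top_of_norm_le_of_sq (hMb τ hτ) ((hCb τ hτ).trans_lt hC) hr

end Slices

/-! ### The two slice inequalities read off the forced Oseen representation -/

section SliceBounds

variable {ν T M G G₂ : ℝ} {g u : ℝ → EuclideanSpace ℝ (Fin 3) → EuclideanSpace ℝ (Fin 3)}
  {p : ℝ → EuclideanSpace ℝ (Fin 3) → ℝ}

/-- **The `L⁶` slice inequality.** Under the standing hypotheses (classical on `[0, T]`, force with
continuous, bounded, weakly divergence-free, `L²`-bounded slices, finite energy, bounded velocity) and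
given the smoothing constants `C36` (heat `L³ → L⁶`), `CF6` (force term in `L⁶`) and Kato's `c₆`: if
`‖u(τ)‖₆ ≤ K_u τ^{-1/4}` on `(0, s)` then
`‖u(s)‖₆ ≤ C36 ‖u(0)‖₃ (νs)^{-1/4} + c₆ ν^{-3/4} K_u² s^{-1/4} + CF6 ν^{-1/2} G₂ s^{1/2}`
(the representation at time `s`, term by term). [cite: Kato1984, (2.3)–(2.4)]
[cite: LemarieRieusset2016, Thm. 15.2 (proof)] -/
theorem eLpNorm_six_slice_le (hν : 0 < ν) (hT : 0 < T)
    (hcl : IsClassicalNSSolutionOn (Icc 0 T) ν g u p) (hgc : Continuous (uncurry g))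
    (hG : ∀ τ ∈ Icc 0 T, ∀ y, ‖g τ y‖ ≤ G) (hgdiv : ∀ τ ∈ Icc 0 T, IsWeaklyDivFree (g τ))
    (hG₂ : 0 ≤ G₂) (hg2 : ∀ τ ∈ Icc 0 T, eLpNorm (g τ) 2 volume ≤ ENNReal.ofReal G₂)
    (hE : ∃ C : ℝ≥0∞, C < ⊤ ∧ ∀ t ∈ Icc 0 T, ∫⁻ x, ‖u t x‖ₑ ^ 2 ≤ C)
    (hM : 0 < M) (hMb : ∀ t ∈ Icc 0 T, ∀ y, ‖u t y‖ ≤ M)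
    {C36 : ℝ≥0} (h36 : ∀ f : EuclideanSpace ℝ (Fin 3) → EuclideanSpace ℝ (Fin 3), MemLp f 3 volume →
      ∀ t : ℝ, 0 < t → eLpNorm (UnboundedOperators.heatExtension f t) 6 volume ≤
        (C36 : ℝ≥0∞) * ENNReal.ofReal (t ^ (-(1 / 4 : ℝ))) * eLpNorm f 3 volume)
    {CF6 : ℝ} (hCF6 : 0 ≤ CF6) (hF6 : ∀ {ν t G₂ : ℝ}
      {g : ℝ → EuclideanSpace ℝ (Fin 3) → EuclideanSpace ℝ (Fin 3)},
      0 < ν → 0 < t → Continuous (uncurry g) → 0 ≤ G₂ →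
      (∀ τ ∈ Ioo 0 t, eLpNorm (g τ) 2 volume ≤ ENNReal.ofReal G₂) →
        eLpNorm (forceDuhamel ν 0 g t) 6 volume ≤
          ENNReal.ofReal (CF6 * ν ^ (-(1 / 2 : ℝ)) * G₂ * t ^ (1 / 2 : ℝ)))
    {c₆ : ℝ} (hc₆ : 0 ≤ c₆) (hK6 : ∀ {ν : ℝ}, 0 < ν →
      ∀ {u v : ℝ → EuclideanSpace ℝ (Fin 3) → EuclideanSpace ℝ (Fin 3)}, Measurable (uncurry u) →
      Measurable (uncurry v) → ∀ {Ku Kv : ℝ}, 0 ≤ Ku → 0 ≤ Kv → ∀ {t : ℝ}, 0 < t →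
        (∀ τ ∈ Ioo 0 t, eLpNorm (u τ) 6 volume ≤ ENNReal.ofReal (Ku * τ ^ (-(1 / 4 : ℝ)))) →
        (∀ τ ∈ Ioo 0 t, eLpNorm (v τ) 6 volume ≤ ENNReal.ofReal (Kv * τ ^ (-(1 / 4 : ℝ)))) →
          eLpNorm (fun x => ∫ τ in Ioo 0 t, ∫ y, oseenKernel (ν * (t - τ)) (x - y) (u τ y) (v τ y))
              6 volume ≤
            ENNReal.ofReal (c₆ * ν ^ (-(3 / 4 : ℝ)) * Ku * Kv * t ^ (-(1 / 4 : ℝ))))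
    {s : ℝ} (hs : s ∈ Ioc 0 T) {Ku : ℝ} (hKu : 0 ≤ Ku)
    (h6 : ∀ τ ∈ Ioo 0 s, eLpNorm (u τ) 6 volume ≤ ENNReal.ofReal (Ku * τ ^ (-(1 / 4 : ℝ)))) :
    eLpNorm (u s) 6 volume ≤
      ENNReal.ofReal (C36 * (eLpNorm (u 0) 3 volume).toReal * (ν * s) ^ (-(1 / 4 : ℝ)) +
        c₆ * ν ^ (-(3 / 4 : ℝ)) * Ku * Ku * s ^ (-(1 / 4 : ℝ)) +
        CF6 * ν ^ (-(1 / 2 : ℝ)) * G₂ * s ^ (1 / 2 : ℝ)) := by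
  have hs0 : 0 < s := hs.1
  have hνs : 0 < ν * s := mul_pos hν hs0
  have h0I : (0 : ℝ) ∈ Icc 0 T := ⟨le_rfl, hT.le⟩
  have hsI : s ∈ Icc 0 T := ⟨hs.1.le, hs.2⟩
  have hgm : StronglyMeasurable (uncurry g) := hgc.stronglyMeasurable
  -- ### the representation at time `s`
  have hrep := hcl.ae_eq_forced_oseenMild hν hT hgc hG hgdiv (G₂ := ENNReal.ofReal G₂)
    ENNReal.ofReal_ne_top hg2 hE hM hMb hs
  -- ### `u 0 ∈ L³`
  set a : ℝ := (eLpNorm (u 0) 3 volume).toReal with ha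
  have h3top : eLpNorm (u 0) 3 volume < ⊤ := by
    have h := eLpNorm_three_slice_lt_top hcl hT hE hMb h0I (r := 3) (by norm_num)
    rwa [ENNReal.ofReal_ofNat] at h
  have hmem3 : MemLp (u 0) 3 volume :=
    ⟨(continuous_slice hcl h0I).aestronglyMeasurable, h3top⟩
  have ha3 : eLpNorm (u 0) 3 volume = ENNReal.ofReal a := by
    rw [ha, ENNReal.ofReal_toReal h3top.ne]
  -- ### heat term
  have hH : eLpNorm (UnboundedOperators.heatExtension (u 0) (ν * s)) 6 volume ≤
      ENNReal.ofReal (C36 * a * (ν * s) ^ (-(1 / 4 : ℝ))) := by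
    refine (h36 (u 0) hmem3 (ν * s) hνs).trans (le_of_eq ?_)
    rw [ha3, ENNReal.coe_nnreal_eq, ← ENNReal.ofReal_mul NNReal.zero_le_coe,
      ← ENNReal.ofReal_mul (by positivity)]
    congr 1; ring
  -- ### bilinear term, through the clamped field
  set ut : ℝ → EuclideanSpace ℝ (Fin 3) → EuclideanSpace ℝ (Fin 3) := fun τ y =>
    u (Set.projIcc 0 T hT.le τ : ℝ) y with hut
  have hum : Measurable (uncurry ut) := measurable_uncurry_clamp hcl hT
  have h6t : ∀ τ ∈ Ioo 0 s, eLpNorm (ut τ) 6 volume ≤ ENNReal.ofReal (Ku * τ ^ (-(1 / 4 : ℝ))) := by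
    intro τ hτ
    have hτI : τ ∈ Icc 0 T := ⟨hτ.1.le, hτ.2.le.trans hs.2⟩
    have heq : ut τ = u τ := by
      funext y; simp only [hut, projIcc_val_of_mem hT hτI]
    rw [heq]; exact h6 τ hτ
  have hB : eLpNorm (oseenDuhamel ν 0 u u s) 6 volume ≤
      ENNReal.ofReal (c₆ * ν ^ (-(3 / 4 : ℝ)) * Ku * Ku * s ^ (-(1 / 4 : ℝ))) := by
    have h := hK6 hν hum hum hKu hKu hs0 h6t h6t
    have heq : oseenDuhamel ν 0 u u s =
        fun x => ∫ τ in Ioo 0 s, ∫ y, oseenKernel (ν * (s - τ)) (x - y) (ut τ y) (ut τ y) := by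
      funext x
      rw [← oseenDuhamel_clamp_eq hT hs x, oseenDuhamel_apply]
    rw [heq]; exact h
  -- ### force term
  have hF : eLpNorm (forceDuhamel ν 0 g s) 6 volume ≤
      ENNReal.ofReal (CF6 * ν ^ (-(1 / 2 : ℝ)) * G₂ * s ^ (1 / 2 : ℝ)) :=
    hF6 hν hs0 hgc hG₂ fun τ hτ => hg2 τ ⟨hτ.1.le, hτ.2.le.trans hs.2⟩
  -- ### measurability of the three pieces
  have hHm : AEStronglyMeasurable (UnboundedOperators.heatExtension (u 0) (ν * s)) volume :=
    (UnboundedOperators.contDiff_heatExtension_holds hmem3 (by norm_num) hνs).continuous.aestronglyMeasurable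
  have hFm : AEStronglyMeasurable (forceDuhamel ν 0 g s) volume :=
    aestronglyMeasurable_forceDuhamel hgm ν 0 s
  have hum_s : AEStronglyMeasurable (u s) volume := (continuous_slice hcl hsI).aestronglyMeasurable
  have hBm : AEStronglyMeasurable (oseenDuhamel ν 0 u u s) volume := by
    -- `B = H + F - u(s)` a.e.
    have hae : oseenDuhamel ν 0 u u s =ᵐ[volume] fun x =>
        UnboundedOperators.heatExtension (u 0) (ν * s) x + forceDuhamel ν 0 g s x - u s x := by
      filter_upwards [hrep] with x hx
      rw [hx]; abel
    exact ((hHm.add hFm).sub hum_s).congr hae.symm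
  -- ### assemble
  have hnn1 : 0 ≤ C36 * a * (ν * s) ^ (-(1 / 4 : ℝ)) := by positivity
  have hnn2 : 0 ≤ c₆ * ν ^ (-(3 / 4 : ℝ)) * Ku * Ku * s ^ (-(1 / 4 : ℝ)) := by positivity
  have hnn3 : 0 ≤ CF6 * ν ^ (-(1 / 2 : ℝ)) * G₂ * s ^ (1 / 2 : ℝ) := by positivity
  calc eLpNorm (u s) 6 volume
      = eLpNorm (fun x => UnboundedOperators.heatExtension (u 0) (ν * s) x - oseenDuhamel ν 0 u u s x +
          forceDuhamel ν 0 g s x) 6 volume := eLpNorm_congr_ae hrep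
    _ ≤ eLpNorm (fun x => UnboundedOperators.heatExtension (u 0) (ν * s) x - oseenDuhamel ν 0 u u s x)
          6 volume + eLpNorm (forceDuhamel ν 0 g s) 6 volume :=
        eLpNorm_add_le (hHm.sub hBm) hFm (by norm_num)
    _ ≤ (eLpNorm (UnboundedOperators.heatExtension (u 0) (ν * s)) 6 volume +
          eLpNorm (oseenDuhamel ν 0 u u s) 6 volume) + eLpNorm (forceDuhamel ν 0 g s) 6 volume := by
        gcongr; exact eLpNorm_sub_le hHm hBm (by norm_num)
    _ ≤ (ENNReal.ofReal (C36 * a * (ν * s) ^ (-(1 / 4 : ℝ))) +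
          ENNReal.ofReal (c₆ * ν ^ (-(3 / 4 : ℝ)) * Ku * Ku * s ^ (-(1 / 4 : ℝ)))) +
          ENNReal.ofReal (CF6 * ν ^ (-(1 / 2 : ℝ)) * G₂ * s ^ (1 / 2 : ℝ)) :=
        add_le_add (add_le_add hH hB) hF
    _ = _ := by rw [← ENNReal.ofReal_add hnn1 hnn2, ← ENNReal.ofReal_add (add_nonneg hnn1 hnn2) hnn3]

/-- **The pointwise slice inequality.** Under the standing hypotheses and given Kato's pointwise
constant `c∞` and the force constant `CF`: if `‖u(τ)‖₆ ≤ K_u τ^{-1/4}` and `|u(τ, ·)| ≤ L_u τ^{-1/2}`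
on `(0, s)`, then for EVERY `x`
`|u(s, x)| ≤ ‖u(0)‖₃ (νs)^{-1/2} + c∞ ν^{-3/4} K_u L_u s^{-1/2} + CF ν^{-3/4} G₂ s^{1/4}`
(heat `L³ → L^∞` with constant `1`, Kato's pointwise estimate, the force term at every point; a.e. from
the representation, everywhere by continuity of `u(s)`). [cite: Kato1984, (2.4')]
[cite: LemarieRieusset2016, Thm. 15.2 (proof)] -/
theorem norm_slice_le (hν : 0 < ν) (hT : 0 < T)
    (hcl : IsClassicalNSSolutionOn (Icc 0 T) ν g u p) (hgc : Continuous (uncurry g))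
    (hG : ∀ τ ∈ Icc 0 T, ∀ y, ‖g τ y‖ ≤ G) (hgdiv : ∀ τ ∈ Icc 0 T, IsWeaklyDivFree (g τ))
    (hG₂ : 0 ≤ G₂) (hg2 : ∀ τ ∈ Icc 0 T, eLpNorm (g τ) 2 volume ≤ ENNReal.ofReal G₂)
    (hE : ∃ C : ℝ≥0∞, C < ⊤ ∧ ∀ t ∈ Icc 0 T, ∫⁻ x, ‖u t x‖ₑ ^ 2 ≤ C)
    (hM : 0 < M) (hMb : ∀ t ∈ Icc 0 T, ∀ y, ‖u t y‖ ≤ M)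
    {CF : ℝ} (hFI : ∀ {ν t G₂ : ℝ}
      {g : ℝ → EuclideanSpace ℝ (Fin 3) → EuclideanSpace ℝ (Fin 3)},
      0 < ν → 0 < t → Continuous (uncurry g) → 0 ≤ G₂ →
      (∀ τ ∈ Ioo 0 t, eLpNorm (g τ) 2 volume ≤ ENNReal.ofReal G₂) →
        ∀ x, ‖forceDuhamel ν 0 g t x‖ ≤ CF * ν ^ (-(3 / 4 : ℝ)) * G₂ * t ^ (1 / 4 : ℝ))
    {cI : ℝ} (hcI : 0 ≤ cI) (hKI : ∀ {ν : ℝ}, 0 < ν →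
      ∀ {u v : ℝ → EuclideanSpace ℝ (Fin 3) → EuclideanSpace ℝ (Fin 3)}, Measurable (uncurry u) →
      Measurable (uncurry v) → ∀ {Ku Lv : ℝ}, 0 ≤ Ku → 0 ≤ Lv → ∀ {t : ℝ}, 0 < t →
        (∀ τ ∈ Ioo 0 t, eLpNorm (u τ) 6 volume ≤ ENNReal.ofReal (Ku * τ ^ (-(1 / 4 : ℝ)))) →
        (∀ τ ∈ Ioo 0 t, eLpNorm (v τ) ∞ volume ≤ ENNReal.ofReal (Lv * τ ^ (-(1 / 2 : ℝ)))) →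
          ∀ x : EuclideanSpace ℝ (Fin 3),
            IntegrableOn (fun τ => ∫ y, oseenKernel (ν * (t - τ)) (x - y) (u τ y) (v τ y))
                (Ioo 0 t) volume ∧
              ‖∫ τ in Ioo 0 t, ∫ y, oseenKernel (ν * (t - τ)) (x - y) (u τ y) (v τ y)‖ ≤
                cI * ν ^ (-(3 / 4 : ℝ)) * Ku * Lv * t ^ (-(1 / 2 : ℝ)))
    {s : ℝ} (hs : s ∈ Ioc 0 T) {Ku Lu : ℝ} (hKu : 0 ≤ Ku) (hLu : 0 ≤ Lu)
    (h6 : ∀ τ ∈ Ioo 0 s, eLpNorm (u τ) 6 volume ≤ ENNReal.ofReal (Ku * τ ^ (-(1 / 4 : ℝ))))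
    (hI : ∀ τ ∈ Ioo 0 s, ∀ y, ‖u τ y‖ ≤ Lu * τ ^ (-(1 / 2 : ℝ))) (x : EuclideanSpace ℝ (Fin 3)) :
    ‖u s x‖ ≤ (eLpNorm (u 0) 3 volume).toReal * (ν * s) ^ (-(1 / 2 : ℝ)) +
      cI * ν ^ (-(3 / 4 : ℝ)) * Ku * Lu * s ^ (-(1 / 2 : ℝ)) + CF * ν ^ (-(3 / 4 : ℝ)) * G₂ * s ^ (1 / 4 : ℝ) := by
  have hs0 : 0 < s := hs.1
  have hνs : 0 < ν * s := mul_pos hν hs0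
  have h0I : (0 : ℝ) ∈ Icc 0 T := ⟨le_rfl, hT.le⟩
  have hsI : s ∈ Icc 0 T := ⟨hs.1.le, hs.2⟩
  -- ### the representation at time `s`
  have hrep := hcl.ae_eq_forced_oseenMild hν hT hgc hG hgdiv (G₂ := ENNReal.ofReal G₂)
    ENNReal.ofReal_ne_top hg2 hE hM hMb hs
  -- ### `u 0 ∈ L³`
  set a : ℝ := (eLpNorm (u 0) 3 volume).toReal with ha
  have h3top : eLpNorm (u 0) 3 volume < ⊤ := by
    have h := eLpNorm_three_slice_lt_top hcl hT hE hMb h0I (r := 3) (by norm_num)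
    rwa [ENNReal.ofReal_ofNat] at h
  have ha0 : 0 ≤ a := ENNReal.toReal_nonneg
  have ha3 : eLpNorm (u 0) (ENNReal.ofReal 3) volume ≤ ENNReal.ofReal a := by
    rw [ENNReal.ofReal_ofNat, ha, ENNReal.ofReal_toReal h3top.ne]
  -- ### heat term (`L³ → L^∞`, constant `1`)
  have hheat := eLpNorm_top_heatExtension_le_of_Lr (continuous_slice hcl h0I).aestronglyMeasurable
    (r := 3) (by norm_num) ha0 ha3 hνs
  have hexp : -(3 / (2 * (3 : ℝ))) = -(1 / 2 : ℝ) := by norm_num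
  rw [hexp, eLpNorm_exponent_top] at hheat
  have hb1 : 0 ≤ a * (ν * s) ^ (-(1 / 2 : ℝ)) := by positivity
  -- ### bilinear term through the clamped field
  set ut : ℝ → EuclideanSpace ℝ (Fin 3) → EuclideanSpace ℝ (Fin 3) := fun τ y =>
    u (Set.projIcc 0 T hT.le τ : ℝ) y with hut
  have hum : Measurable (uncurry ut) := measurable_uncurry_clamp hcl hT
  have hutτ : ∀ τ ∈ Ioo 0 s, ut τ = u τ := by
    intro τ hτ
    have hτI : τ ∈ Icc 0 T := ⟨hτ.1.le, hτ.2.le.trans hs.2⟩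
    funext y; simp only [hut, projIcc_val_of_mem hT hτI]
  have h6t : ∀ τ ∈ Ioo 0 s, eLpNorm (ut τ) 6 volume ≤ ENNReal.ofReal (Ku * τ ^ (-(1 / 4 : ℝ))) :=
    fun τ hτ => by rw [hutτ τ hτ]; exact h6 τ hτ
  have hIt : ∀ τ ∈ Ioo 0 s, eLpNorm (ut τ) ∞ volume ≤ ENNReal.ofReal (Lu * τ ^ (-(1 / 2 : ℝ))) := by
    intro τ hτ
    rw [hutτ τ hτ, eLpNorm_exponent_top]
    exact eLpNormEssSup_le_of_ae_bound (Eventually.of_forall fun y => hI τ hτ y)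
  have hB : ∀ y, ‖oseenDuhamel ν 0 u u s y‖ ≤ cI * ν ^ (-(3 / 4 : ℝ)) * Ku * Lu * s ^ (-(1 / 2 : ℝ)) := by
    intro y
    have h := (hKI hν hum hum hKu hLu hs0 h6t hIt y).2
    rwa [← oseenDuhamel_apply, oseenDuhamel_clamp_eq hT hs y] at h
  have hb2 : 0 ≤ cI * ν ^ (-(3 / 4 : ℝ)) * Ku * Lu * s ^ (-(1 / 2 : ℝ)) := by positivity
  -- ### force term
  have hF : ∀ y, ‖forceDuhamel ν 0 g s y‖ ≤ CF * ν ^ (-(3 / 4 : ℝ)) * G₂ * s ^ (1 / 4 : ℝ) :=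
    hFI hν hs0 hgc hG₂ fun τ hτ => hg2 τ ⟨hτ.1.le, hτ.2.le.trans hs.2⟩
  -- ### the bound a.e., then everywhere by continuity of `u s`
  have hae : ∀ᵐ y ∂(volume : Measure (EuclideanSpace ℝ (Fin 3))),
      ‖u s y‖ ≤ a * (ν * s) ^ (-(1 / 2 : ℝ)) +
        cI * ν ^ (-(3 / 4 : ℝ)) * Ku * Lu * s ^ (-(1 / 2 : ℝ)) + CF * ν ^ (-(3 / 4 : ℝ)) * G₂ * s ^ (1 / 4 : ℝ) := by
    have hh := ae_le_eLpNormEssSup (f := UnboundedOperators.heatExtension (u 0) (ν * s))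
      (μ := (volume : Measure (EuclideanSpace ℝ (Fin 3))))
    filter_upwards [hrep, hh] with y hy hy'
    rw [hy]
    have hh1 : ‖UnboundedOperators.heatExtension (u 0) (ν * s) y‖ ≤ a * (ν * s) ^ (-(1 / 2 : ℝ)) := by
      have := hy'.trans hheat
      rwa [← ofReal_norm, ENNReal.ofReal_le_ofReal_iff hb1] at this
    calc ‖UnboundedOperators.heatExtension (u 0) (ν * s) y - oseenDuhamel ν 0 u u s y +
          forceDuhamel ν 0 g s y‖
        ≤ ‖UnboundedOperators.heatExtension (u 0) (ν * s) y - oseenDuhamel ν 0 u u s y‖ +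
          ‖forceDuhamel ν 0 g s y‖ := norm_add_le _ _
      _ ≤ (‖UnboundedOperators.heatExtension (u 0) (ν * s) y‖ + ‖oseenDuhamel ν 0 u u s y‖) +
          ‖forceDuhamel ν 0 g s y‖ := by gcongr; exact norm_sub_le _ _
      _ ≤ (a * (ν * s) ^ (-(1 / 2 : ℝ)) + cI * ν ^ (-(3 / 4 : ℝ)) * Ku * Lu * s ^ (-(1 / 2 : ℝ))) +
          CF * ν ^ (-(3 / 4 : ℝ)) * G₂ * s ^ (1 / 4 : ℝ) := add_le_add (add_le_add hh1 (hB y)) (hF y)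
  exact forall_norm_le_of_ae_norm_le (continuous_slice hcl hsI) hae x

end SliceBounds

/-! ### Weight algebra -/

section Algebra

/-- The `L⁶` weight identity: `s^{1/4} ν^{-3/4} · (C a (νs)^{-1/4} + c ν^{-3/4} (kν^{3/4})² s^{-1/4}
+ C' ν^{-1/2} G s^{1/2}) = C a/ν + c k² + C' G s^{3/4} / ν^{5/4}`. [folklore] -/
private theorem alg_six {ν s C a c k C' G : ℝ} (hν : 0 < ν) (hs : 0 < s) :
    s ^ (1 / 4 : ℝ) * ν ^ (-(3 / 4 : ℝ)) *
        (C * a * (ν * s) ^ (-(1 / 4 : ℝ)) +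
          c * ν ^ (-(3 / 4 : ℝ)) * (k * ν ^ (3 / 4 : ℝ)) * (k * ν ^ (3 / 4 : ℝ)) * s ^ (-(1 / 4 : ℝ)) +
          C' * ν ^ (-(1 / 2 : ℝ)) * G * s ^ (1 / 2 : ℝ)) =
      C * (a / ν) + c * k ^ 2 + C' * (s ^ (3 / 4 : ℝ) * G / ν ^ (5 / 4 : ℝ)) := by
  have e1 : (ν * s) ^ (-(1 / 4 : ℝ)) = ν ^ (-(1 / 4 : ℝ)) * s ^ (-(1 / 4 : ℝ)) :=
    Real.mul_rpow hν.le hs.le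
  have e2 : s ^ (1 / 4 : ℝ) * s ^ (-(1 / 4 : ℝ)) = 1 := by
    rw [← Real.rpow_add hs]; norm_num
  have e3 : ν ^ (-(3 / 4 : ℝ)) * ν ^ (-(1 / 4 : ℝ)) = ν⁻¹ := by
    rw [← Real.rpow_add hν, ← Real.rpow_neg_one]; norm_num
  have e4 : ν ^ (-(3 / 4 : ℝ)) * ν ^ (-(3 / 4 : ℝ)) * ν ^ (3 / 4 : ℝ) * ν ^ (3 / 4 : ℝ) = 1 := by
    rw [← Real.rpow_add hν, ← Real.rpow_add hν, ← Real.rpow_add hν]; norm_num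
  have e5 : s ^ (1 / 4 : ℝ) * s ^ (1 / 2 : ℝ) = s ^ (3 / 4 : ℝ) := by
    rw [← Real.rpow_add hs]; norm_num
  have e6 : ν ^ (-(3 / 4 : ℝ)) * ν ^ (-(1 / 2 : ℝ)) = (ν ^ (5 / 4 : ℝ))⁻¹ := by
    rw [← Real.rpow_add hν, ← Real.rpow_neg hν.le]; norm_num
  calc s ^ (1 / 4 : ℝ) * ν ^ (-(3 / 4 : ℝ)) *
        (C * a * (ν * s) ^ (-(1 / 4 : ℝ)) +
          c * ν ^ (-(3 / 4 : ℝ)) * (k * ν ^ (3 / 4 : ℝ)) * (k * ν ^ (3 / 4 : ℝ)) * s ^ (-(1 / 4 : ℝ)) +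
          C' * ν ^ (-(1 / 2 : ℝ)) * G * s ^ (1 / 2 : ℝ))
      = C * a * ((s ^ (1 / 4 : ℝ) * s ^ (-(1 / 4 : ℝ))) * (ν ^ (-(3 / 4 : ℝ)) * ν ^ (-(1 / 4 : ℝ)))) +
        c * k ^ 2 * ((s ^ (1 / 4 : ℝ) * s ^ (-(1 / 4 : ℝ))) *
          (ν ^ (-(3 / 4 : ℝ)) * ν ^ (-(3 / 4 : ℝ)) * ν ^ (3 / 4 : ℝ) * ν ^ (3 / 4 : ℝ))) +
        C' * G * ((s ^ (1 / 4 : ℝ) * s ^ (1 / 2 : ℝ)) * (ν ^ (-(3 / 4 : ℝ)) * ν ^ (-(1 / 2 : ℝ)))) := by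
        rw [e1]; ring
    _ = C * a * ν⁻¹ + c * k ^ 2 + C' * G * (s ^ (3 / 4 : ℝ) * (ν ^ (5 / 4 : ℝ))⁻¹) := by
        rw [e2, e3, e4, e5, e6]; ring
    _ = C * (a / ν) + c * k ^ 2 + C' * (s ^ (3 / 4 : ℝ) * G / ν ^ (5 / 4 : ℝ)) := by ring

/-- The `L^∞` weight identity: `s^{1/2} · (a (νs)^{-1/2} + c ν^{-3/4} (kν^{3/4}) ℓ s^{-1/2}
+ C' ν^{-3/4} G s^{1/4}) = ν^{1/2} (a/ν) + c k ℓ + ν^{1/2} C' (s^{3/4} G / ν^{5/4})`. [folklore] -/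
private theorem alg_sup {ν s a c k ℓ C' G : ℝ} (hν : 0 < ν) (hs : 0 < s) :
    s ^ (1 / 2 : ℝ) *
        (a * (ν * s) ^ (-(1 / 2 : ℝ)) + c * ν ^ (-(3 / 4 : ℝ)) * (k * ν ^ (3 / 4 : ℝ)) * ℓ * s ^ (-(1 / 2 : ℝ)) +
          C' * ν ^ (-(3 / 4 : ℝ)) * G * s ^ (1 / 4 : ℝ)) =
      ν ^ (1 / 2 : ℝ) * (a / ν) + c * k * ℓ + ν ^ (1 / 2 : ℝ) * (C' * (s ^ (3 / 4 : ℝ) * G / ν ^ (5 / 4 : ℝ))) := by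
  have e1 : (ν * s) ^ (-(1 / 2 : ℝ)) = ν ^ (-(1 / 2 : ℝ)) * s ^ (-(1 / 2 : ℝ)) :=
    Real.mul_rpow hν.le hs.le
  have e2 : s ^ (1 / 2 : ℝ) * s ^ (-(1 / 2 : ℝ)) = 1 := by
    rw [← Real.rpow_add hs]; norm_num
  have e3 : ν ^ (-(1 / 2 : ℝ)) = ν ^ (1 / 2 : ℝ) * ν⁻¹ := by
    rw [← Real.rpow_neg_one, ← Real.rpow_add hν]; norm_num
  have e4 : ν ^ (-(3 / 4 : ℝ)) * ν ^ (3 / 4 : ℝ) = 1 := by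
    rw [← Real.rpow_add hν]; norm_num
  have e5 : s ^ (1 / 2 : ℝ) * s ^ (1 / 4 : ℝ) = s ^ (3 / 4 : ℝ) := by
    rw [← Real.rpow_add hs]; norm_num
  have e6 : ν ^ (-(3 / 4 : ℝ)) = ν ^ (1 / 2 : ℝ) * (ν ^ (5 / 4 : ℝ))⁻¹ := by
    rw [← Real.rpow_neg hν.le, ← Real.rpow_add hν]; norm_num
  calc s ^ (1 / 2 : ℝ) *
        (a * (ν * s) ^ (-(1 / 2 : ℝ)) + c * ν ^ (-(3 / 4 : ℝ)) * (k * ν ^ (3 / 4 : ℝ)) * ℓ * s ^ (-(1 / 2 : ℝ)) +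
          C' * ν ^ (-(3 / 4 : ℝ)) * G * s ^ (1 / 4 : ℝ))
      = a * ν ^ (-(1 / 2 : ℝ)) * (s ^ (1 / 2 : ℝ) * s ^ (-(1 / 2 : ℝ))) +
        c * k * ℓ * ((s ^ (1 / 2 : ℝ) * s ^ (-(1 / 2 : ℝ))) * (ν ^ (-(3 / 4 : ℝ)) * ν ^ (3 / 4 : ℝ))) +
        C' * G * ν ^ (-(3 / 4 : ℝ)) * (s ^ (1 / 2 : ℝ) * s ^ (1 / 4 : ℝ)) := by
        rw [e1]; ring
    _ = a * (ν ^ (1 / 2 : ℝ) * ν⁻¹) + c * k * ℓ +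
        C' * G * (ν ^ (1 / 2 : ℝ) * (ν ^ (5 / 4 : ℝ))⁻¹) * s ^ (3 / 4 : ℝ) := by
        rw [e2, e4, e5, ← e3, ← e6]; ring
    _ = _ := by ring

end Algebra

/-! ### Two abstract real-variable tools for the bootstrap -/

section Tools

/-- **Continuous induction on `[0, T]`** (first-bad-time argument): if `φ` is continuous on `[0, T]`,
`φ(0) < k`, and at every `s ∈ (0, T]` below which `φ ≤ k` one has the STRICT improvement `φ(s) < k`,
then `φ ≤ k` on `[0, T]`. [folklore] -/
private theorem forall_le_of_improve {φ : ℝ → ℝ} {T k : ℝ} (hφc : ContinuousOn φ (Icc 0 T))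
    (hφ0 : φ 0 < k) (himp : ∀ s ∈ Ioc 0 T, (∀ τ ∈ Ioo 0 s, φ τ ≤ k) → φ s < k) :
    ∀ s ∈ Icc 0 T, φ s ≤ k := by
  by_contra hcon
  push Not at hcon
  obtain ⟨s₁, hs₁, hs₁k⟩ := hcon
  set B : Set ℝ := {s | s ∈ Icc 0 T ∧ k < φ s} with hB
  have hBne : B.Nonempty := ⟨s₁, hs₁, hs₁k⟩
  have hBbdd : BddBelow B := ⟨0, fun s hs => hs.1.1⟩
  set s₀ : ℝ := sInf B with hs₀def
  have hs₀0 : 0 ≤ s₀ := le_csInf hBne fun s hs => hs.1.1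
  have hs₀T : s₀ ≤ T := (csInf_le hBbdd ⟨hs₁, hs₁k⟩).trans hs₁.2
  have hs₀I : s₀ ∈ Icc 0 T := ⟨hs₀0, hs₀T⟩
  -- below `s₀` the bound holds
  have hbelow : ∀ τ ∈ Icc 0 T, τ < s₀ → φ τ ≤ k := by
    intro τ hτ hτs
    by_contra hlt
    push Not at hlt
    exact absurd (csInf_le hBbdd ⟨hτ, hlt⟩) (not_le.2 hτs)
  -- at `s₀` the bound fails (weakly), by continuity
  have hat : k ≤ φ s₀ := by
    by_contra hlt
    push Not at hlt
    have hev : ∀ᶠ s in 𝓝[Icc 0 T] s₀, φ s < k := (hφc s₀ hs₀I).eventually (Iio_mem_nhds hlt)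
    obtain ⟨ε, hε, hεb⟩ := Metric.eventually_nhds_iff.1 (eventually_nhdsWithin_iff.1 hev)
    obtain ⟨b, hbB, hbε⟩ := exists_lt_of_csInf_lt hBne (lt_add_of_pos_right s₀ hε)
    have hs₀b : s₀ ≤ b := csInf_le hBbdd hbB
    have hdist : dist b s₀ < ε := by
      rw [Real.dist_eq, abs_of_nonneg (sub_nonneg.2 hs₀b)]; linarith
    exact absurd (hεb hdist hbB.1) (not_lt.2 hbB.2.le)
  -- `s₀ > 0` since `φ 0 < k`
  have hs₀pos : 0 < s₀ := by
    rcases hs₀0.eq_or_lt with h | h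
    · rw [← h] at hat; linarith
    · exact h
  have h := himp s₀ ⟨hs₀pos, hs₀T⟩ fun τ hτ => hbelow τ ⟨hτ.1.le, hτ.2.le.trans hs₀T⟩ hτ.2
  linarith

/-- **`η → 0`**: if `x ≤ (A + η) W` for every `η ∈ (0, η₀]` (`η₀, W > 0`), then `x ≤ A W`. [folklore] -/
private theorem le_mul_of_forall_eta {x A W η₀ : ℝ} (hη₀ : 0 < η₀) (hW : 0 < W)
    (h : ∀ η, 0 < η → η ≤ η₀ → x ≤ (A + η) * W) : x ≤ A * W := by
  refine le_of_forall_pos_le_add fun ε hε => ?_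
  set η : ℝ := min η₀ (ε / W) with hη
  have hη0 : 0 < η := lt_min hη₀ (div_pos hε hW)
  have hηW : η * W ≤ ε := by
    calc η * W ≤ ε / W * W := mul_le_mul_of_nonneg_right (min_le_right _ _) hW.le
      _ = ε := div_mul_cancel₀ ε hW.ne'
  have h1 := h η hη0 (min_le_left _ _)
  calc x ≤ (A + η) * W := h1
    _ = A * W + η * W := by ring
    _ ≤ A * W + ε := by linarith

end Tools

/-! ### The a-priori bound -/

section Main

variable {ν T M G G₂ : ℝ} {g u : ℝ → EuclideanSpace ℝ (Fin 3) → EuclideanSpace ℝ (Fin 3)}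
  {p : ℝ → EuclideanSpace ℝ (Fin 3) → ℝ}

/-- **The `L⁶` bootstrap.** Under the standing hypotheses, the smoothing constants dominated by
`C₀ ≥ 1`, Kato's `c₆` with `12 c₆ C₀ ε₀ ≤ 1`, continuity of `t ↦ ‖u(t)‖₆` on `[0, T]` and the smallness
`δ = ‖u(0)‖₃/ν + T^{3/4}G₂/ν^{5/4} ≤ ε₀`: `‖u(s)‖₆ ≤ 2C₀ δ ν^{3/4} s^{-1/4}` for all `s ∈ (0, T]`
(continuous induction on the weighted norm `s^{1/4}ν^{-3/4}‖u(s)‖₆`, with margin `η ↓ 0`). [cite: Kato1984, Thm. 2 with (2.3)–(2.4)] -/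
theorem eLpNorm_six_apriori (hν : 0 < ν) (hT : 0 < T)
    (hcl : IsClassicalNSSolutionOn (Icc 0 T) ν g u p) (hgc : Continuous (uncurry g))
    (hG : ∀ τ ∈ Icc 0 T, ∀ y, ‖g τ y‖ ≤ G) (hgdiv : ∀ τ ∈ Icc 0 T, IsWeaklyDivFree (g τ))
    (hG₂ : 0 ≤ G₂) (hg2 : ∀ τ ∈ Icc 0 T, eLpNorm (g τ) 2 volume ≤ ENNReal.ofReal G₂)
    (hE : ∃ C : ℝ≥0∞, C < ⊤ ∧ ∀ t ∈ Icc 0 T, ∫⁻ x, ‖u t x‖ₑ ^ 2 ≤ C)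
    (hM : 0 < M) (hMb : ∀ t ∈ Icc 0 T, ∀ y, ‖u t y‖ ≤ M)
    (h6c : ContinuousOn (fun t => eLpNorm (u t) 6 volume) (Icc 0 T))
    {C36 : ℝ≥0} (h36 : ∀ f : EuclideanSpace ℝ (Fin 3) → EuclideanSpace ℝ (Fin 3), MemLp f 3 volume →
      ∀ t : ℝ, 0 < t → eLpNorm (UnboundedOperators.heatExtension f t) 6 volume ≤
        (C36 : ℝ≥0∞) * ENNReal.ofReal (t ^ (-(1 / 4 : ℝ))) * eLpNorm f 3 volume)
    {CF6 : ℝ} (hCF6 : 0 ≤ CF6) (hF6 : ∀ {ν t G₂ : ℝ}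
      {g : ℝ → EuclideanSpace ℝ (Fin 3) → EuclideanSpace ℝ (Fin 3)},
      0 < ν → 0 < t → Continuous (uncurry g) → 0 ≤ G₂ →
      (∀ τ ∈ Ioo 0 t, eLpNorm (g τ) 2 volume ≤ ENNReal.ofReal G₂) →
        eLpNorm (forceDuhamel ν 0 g t) 6 volume ≤
          ENNReal.ofReal (CF6 * ν ^ (-(1 / 2 : ℝ)) * G₂ * t ^ (1 / 2 : ℝ)))
    {c₆ : ℝ} (hc₆ : 0 ≤ c₆) (hK6 : ∀ {ν : ℝ}, 0 < ν →
      ∀ {u v : ℝ → EuclideanSpace ℝ (Fin 3) → EuclideanSpace ℝ (Fin 3)}, Measurable (uncurry u) →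
      Measurable (uncurry v) → ∀ {Ku Kv : ℝ}, 0 ≤ Ku → 0 ≤ Kv → ∀ {t : ℝ}, 0 < t →
        (∀ τ ∈ Ioo 0 t, eLpNorm (u τ) 6 volume ≤ ENNReal.ofReal (Ku * τ ^ (-(1 / 4 : ℝ)))) →
        (∀ τ ∈ Ioo 0 t, eLpNorm (v τ) 6 volume ≤ ENNReal.ofReal (Kv * τ ^ (-(1 / 4 : ℝ)))) →
          eLpNorm (fun x => ∫ τ in Ioo 0 t, ∫ y, oseenKernel (ν * (t - τ)) (x - y) (u τ y) (v τ y))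
              6 volume ≤
            ENNReal.ofReal (c₆ * ν ^ (-(3 / 4 : ℝ)) * Ku * Kv * t ^ (-(1 / 4 : ℝ))))
    {C₀ ε₀ : ℝ} (hC₀1 : 1 ≤ C₀) (h36C : (C36 : ℝ) ≤ C₀) (hF6C : CF6 ≤ C₀) (hε₀ : 0 < ε₀)
    (hc₆ε : 12 * c₆ * C₀ * ε₀ ≤ 1)
    (hδ : (eLpNorm (u 0) 3 volume).toReal / ν + T ^ (3 / 4 : ℝ) * G₂ / ν ^ (5 / 4 : ℝ) ≤ ε₀)
    {s : ℝ} (hs : s ∈ Ioc 0 T) :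
    eLpNorm (u s) 6 volume ≤ ENNReal.ofReal (2 * C₀ *
      ((eLpNorm (u 0) 3 volume).toReal / ν + T ^ (3 / 4 : ℝ) * G₂ / ν ^ (5 / 4 : ℝ)) *
        ν ^ (3 / 4 : ℝ) * s ^ (-(1 / 4 : ℝ))) := by
  set a : ℝ := (eLpNorm (u 0) 3 volume).toReal with ha
  have ha0 : 0 ≤ a := ENNReal.toReal_nonneg
  set δ : ℝ := a / ν + T ^ (3 / 4 : ℝ) * G₂ / ν ^ (5 / 4 : ℝ) with hδdef
  have hδ0 : 0 ≤ δ := by positivity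
  have hC₀0 : 0 < C₀ := by linarith
  -- finiteness of the `L⁶` norms of the slices
  have h6top : ∀ τ ∈ Icc 0 T, eLpNorm (u τ) 6 volume < ⊤ := by
    intro τ hτ
    have h := eLpNorm_three_slice_lt_top hcl hT hE hMb hτ (r := 6) (by norm_num)
    rwa [ENNReal.ofReal_ofNat] at h
  -- the force weight at times `s ≤ T`
  have hforceT : ∀ {σ : ℝ}, 0 < σ → σ ≤ T →
      σ ^ (3 / 4 : ℝ) * G₂ / ν ^ (5 / 4 : ℝ) ≤ T ^ (3 / 4 : ℝ) * G₂ / ν ^ (5 / 4 : ℝ) := by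
    intro σ hσ0 hσT
    have hν54 : 0 < ν ^ (5 / 4 : ℝ) := Real.rpow_pos_of_pos hν _
    gcongr
  -- ### the bound with margin `η`
  have hA : ∀ η : ℝ, 0 < η → η ≤ C₀ * ε₀ →
      (eLpNorm (u s) 6 volume).toReal ≤ (2 * C₀ * δ + η) * (ν ^ (3 / 4 : ℝ) * s ^ (-(1 / 4 : ℝ))) := by
    intro η hη hηε
    set k : ℝ := 2 * C₀ * δ + η with hk
    have hk0 : 0 < k := by positivity
    -- `c₆ k ≤ 1/4`
    have hk_le : k ≤ 3 * C₀ * ε₀ := by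
      have h1 : C₀ * δ ≤ C₀ * ε₀ := mul_le_mul_of_nonneg_left hδ hC₀0.le
      rw [hk]; linarith
    have hc₆k : c₆ * k ≤ 1 / 4 := by
      have h1 : c₆ * k ≤ c₆ * (3 * C₀ * ε₀) := mul_le_mul_of_nonneg_left hk_le hc₆
      have h2 : c₆ * (3 * C₀ * ε₀) = (12 * c₆ * C₀ * ε₀) / 4 := by ring
      linarith
    -- from the weighted bound `≤ k` to the weight hypothesis
    have hweight : ∀ {τ : ℝ}, τ ∈ Ioc 0 T →
        τ ^ (1 / 4 : ℝ) * ν ^ (-(3 / 4 : ℝ)) * (eLpNorm (u τ) 6 volume).toReal ≤ k →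
        eLpNorm (u τ) 6 volume ≤ ENNReal.ofReal (k * ν ^ (3 / 4 : ℝ) * τ ^ (-(1 / 4 : ℝ))) := by
      intro τ hτ hφτ
      have hτ0 : 0 < τ := hτ.1
      have hfac : 0 ≤ ν ^ (3 / 4 : ℝ) * τ ^ (-(1 / 4 : ℝ)) := by positivity
      have e1 : τ ^ (1 / 4 : ℝ) * τ ^ (-(1 / 4 : ℝ)) = 1 := by
        rw [← Real.rpow_add hτ0]; norm_num
      have e2 : ν ^ (-(3 / 4 : ℝ)) * ν ^ (3 / 4 : ℝ) = 1 := by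
        rw [← Real.rpow_add hν]; norm_num
      have hid : (eLpNorm (u τ) 6 volume).toReal =
          τ ^ (1 / 4 : ℝ) * ν ^ (-(3 / 4 : ℝ)) * (eLpNorm (u τ) 6 volume).toReal *
            (ν ^ (3 / 4 : ℝ) * τ ^ (-(1 / 4 : ℝ))) := by
        calc (eLpNorm (u τ) 6 volume).toReal
            = (τ ^ (1 / 4 : ℝ) * τ ^ (-(1 / 4 : ℝ))) * (ν ^ (-(3 / 4 : ℝ)) * ν ^ (3 / 4 : ℝ)) *
                (eLpNorm (u τ) 6 volume).toReal := by rw [e1, e2, one_mul, one_mul]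
          _ = _ := by ring
      rw [ENNReal.le_ofReal_iff_toReal_le (h6top τ ⟨hτ.1.le, hτ.2⟩).ne (by positivity), hid,
        show k * ν ^ (3 / 4 : ℝ) * τ ^ (-(1 / 4 : ℝ)) = k * (ν ^ (3 / 4 : ℝ) * τ ^ (-(1 / 4 : ℝ))) by ring]
      exact mul_le_mul_of_nonneg_right hφτ hfac
    -- the strict improvement below a good time
    have himprove : ∀ s₀ ∈ Ioc 0 T,
        (∀ τ ∈ Ioo 0 s₀, τ ^ (1 / 4 : ℝ) * ν ^ (-(3 / 4 : ℝ)) * (eLpNorm (u τ) 6 volume).toReal ≤ k) →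
        s₀ ^ (1 / 4 : ℝ) * ν ^ (-(3 / 4 : ℝ)) * (eLpNorm (u s₀) 6 volume).toReal < k := by
      intro s₀ hs₀ hbelow
      have hs₀0 : 0 < s₀ := hs₀.1
      have h6 : ∀ τ ∈ Ioo 0 s₀, eLpNorm (u τ) 6 volume ≤
          ENNReal.ofReal (k * ν ^ (3 / 4 : ℝ) * τ ^ (-(1 / 4 : ℝ))) :=
        fun τ hτ => hweight ⟨hτ.1, hτ.2.le.trans hs₀.2⟩ (hbelow τ hτ)
      have hslice := eLpNorm_six_slice_le hν hT hcl hgc hG hgdiv hG₂ hg2 hE hM hMb h36 hCF6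
        (fun {ν' t' G' g'} => hF6) hc₆ (fun {ν'} => hK6) hs₀ (Ku := k * ν ^ (3 / 4 : ℝ))
        (by positivity) h6
      have hR0 : 0 ≤ (C36 : ℝ) * a * (ν * s₀) ^ (-(1 / 4 : ℝ)) +
          c₆ * ν ^ (-(3 / 4 : ℝ)) * (k * ν ^ (3 / 4 : ℝ)) * (k * ν ^ (3 / 4 : ℝ)) * s₀ ^ (-(1 / 4 : ℝ)) +
          CF6 * ν ^ (-(1 / 2 : ℝ)) * G₂ * s₀ ^ (1 / 2 : ℝ) := by positivity
      have h1 := ENNReal.toReal_le_of_le_ofReal hR0 hslice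
      have hw0 : 0 ≤ s₀ ^ (1 / 4 : ℝ) * ν ^ (-(3 / 4 : ℝ)) := by positivity
      have h2 : s₀ ^ (1 / 4 : ℝ) * ν ^ (-(3 / 4 : ℝ)) * (eLpNorm (u s₀) 6 volume).toReal ≤
          (C36 : ℝ) * (a / ν) + c₆ * k ^ 2 + CF6 * (s₀ ^ (3 / 4 : ℝ) * G₂ / ν ^ (5 / 4 : ℝ)) := by
        have h := mul_le_mul_of_nonneg_left h1 hw0
        rwa [alg_six hν hs₀0] at h
      -- `C36 a/ν + CF6 (…) ≤ C₀ δ = (k - η)/2` and `c₆ k² ≤ k/4`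
      have h3 : (C36 : ℝ) * (a / ν) + CF6 * (s₀ ^ (3 / 4 : ℝ) * G₂ / ν ^ (5 / 4 : ℝ)) ≤ C₀ * δ := by
        have ha' : 0 ≤ a / ν := by positivity
        have hb' : 0 ≤ T ^ (3 / 4 : ℝ) * G₂ / ν ^ (5 / 4 : ℝ) := by positivity
        have i1 : (C36 : ℝ) * (a / ν) ≤ C₀ * (a / ν) := mul_le_mul_of_nonneg_right h36C ha'
        have i2 : CF6 * (s₀ ^ (3 / 4 : ℝ) * G₂ / ν ^ (5 / 4 : ℝ)) ≤
            C₀ * (T ^ (3 / 4 : ℝ) * G₂ / ν ^ (5 / 4 : ℝ)) :=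
          (mul_le_mul_of_nonneg_left (hforceT hs₀0 hs₀.2) hCF6).trans
            (mul_le_mul_of_nonneg_right hF6C hb')
        have i3 : C₀ * (a / ν) + C₀ * (T ^ (3 / 4 : ℝ) * G₂ / ν ^ (5 / 4 : ℝ)) = C₀ * δ := by
          rw [hδdef]; ring
        linarith
      have h4 : c₆ * k ^ 2 ≤ k / 4 := by
        have h := mul_le_mul_of_nonneg_right hc₆k hk0.le
        have e : c₆ * k ^ 2 = c₆ * k * k := by ring
        rw [e]; linarith
      have h5 : C₀ * δ = (k - η) / 2 := by rw [hk]; ring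
      linarith
    -- continuous induction
    have hφc : ContinuousOn (fun τ => τ ^ (1 / 4 : ℝ) * ν ^ (-(3 / 4 : ℝ)) * (eLpNorm (u τ) 6 volume).toReal)
        (Icc 0 T) := by
      have h1 : ContinuousOn (fun τ : ℝ => τ ^ (1 / 4 : ℝ)) (Icc 0 T) :=
        continuousOn_id.rpow_const fun τ _ => Or.inr (by norm_num)
      have h2 : ContinuousOn (fun τ => (eLpNorm (u τ) 6 volume).toReal) (Icc 0 T) :=
        ENNReal.continuousOn_toReal.comp h6c fun τ hτ => (h6top τ hτ).ne
      exact (h1.mul continuousOn_const).mul h2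
    have hφ0 : (0 : ℝ) ^ (1 / 4 : ℝ) * ν ^ (-(3 / 4 : ℝ)) * (eLpNorm (u 0) 6 volume).toReal < k := by
      rw [Real.zero_rpow (by norm_num : (1 / 4 : ℝ) ≠ 0), zero_mul, zero_mul]; exact hk0
    have hall := forall_le_of_improve hφc hφ0 himprove
    -- read off at `s`
    have hws := hweight hs (hall s ⟨hs.1.le, hs.2⟩)
    have hR : 0 ≤ k * ν ^ (3 / 4 : ℝ) * s ^ (-(1 / 4 : ℝ)) := by
      have := hs.1; positivity
    have h := ENNReal.toReal_le_of_le_ofReal hR hws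
    simpa only [hk, mul_assoc] using h
  -- ### `η → 0`
  have hW : 0 < ν ^ (3 / 4 : ℝ) * s ^ (-(1 / 4 : ℝ)) := by have := hs.1; positivity
  have hX := le_mul_of_forall_eta (by positivity : 0 < C₀ * ε₀) hW hA
  rw [ENNReal.le_ofReal_iff_toReal_le (h6top s ⟨hs.1.le, hs.2⟩).ne (by have := hs.1; positivity)]
  simpa only [hδdef, ha, mul_assoc] using hX

/-- **The sup bound from the `L⁶` bound** (the LINEAR step). Under the standing hypotheses, Kato's
pointwise constant `cI`, the force constant `CF ≤ C₀`, the `L⁶` bound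
`‖u(τ)‖₆ ≤ 2C₀δ ν^{3/4} τ^{-1/4}` on `(0, T]` and `cI (2C₀δ) ≤ 1/4`:
`|u(t, x)| ≤ 2 C₀ δ ν^{1/2} t^{-1/2}` on `(0, T] × ℝ³` (the weighted sup
`ℓ = sup √s |u(s,x)|` is finite and satisfies `ℓ ≤ C₀ δ √ν + ℓ/4`). [cite: Kato1984, Thm. 2 with (2.4')] -/
theorem norm_apriori (hν : 0 < ν) (hT : 0 < T)
    (hcl : IsClassicalNSSolutionOn (Icc 0 T) ν g u p) (hgc : Continuous (uncurry g))
    (hG : ∀ τ ∈ Icc 0 T, ∀ y, ‖g τ y‖ ≤ G) (hgdiv : ∀ τ ∈ Icc 0 T, IsWeaklyDivFree (g τ))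
    (hG₂ : 0 ≤ G₂) (hg2 : ∀ τ ∈ Icc 0 T, eLpNorm (g τ) 2 volume ≤ ENNReal.ofReal G₂)
    (hE : ∃ C : ℝ≥0∞, C < ⊤ ∧ ∀ t ∈ Icc 0 T, ∫⁻ x, ‖u t x‖ₑ ^ 2 ≤ C)
    (hM : 0 < M) (hMb : ∀ t ∈ Icc 0 T, ∀ y, ‖u t y‖ ≤ M)
    {CF : ℝ} (hCF : 0 ≤ CF) (hFI : ∀ {ν t G₂ : ℝ}
      {g : ℝ → EuclideanSpace ℝ (Fin 3) → EuclideanSpace ℝ (Fin 3)},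
      0 < ν → 0 < t → Continuous (uncurry g) → 0 ≤ G₂ →
      (∀ τ ∈ Ioo 0 t, eLpNorm (g τ) 2 volume ≤ ENNReal.ofReal G₂) →
        ∀ x, ‖forceDuhamel ν 0 g t x‖ ≤ CF * ν ^ (-(3 / 4 : ℝ)) * G₂ * t ^ (1 / 4 : ℝ))
    {cI : ℝ} (hcI : 0 ≤ cI) (hKI : ∀ {ν : ℝ}, 0 < ν →
      ∀ {u v : ℝ → EuclideanSpace ℝ (Fin 3) → EuclideanSpace ℝ (Fin 3)}, Measurable (uncurry u) →
      Measurable (uncurry v) → ∀ {Ku Lv : ℝ}, 0 ≤ Ku → 0 ≤ Lv → ∀ {t : ℝ}, 0 < t →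
        (∀ τ ∈ Ioo 0 t, eLpNorm (u τ) 6 volume ≤ ENNReal.ofReal (Ku * τ ^ (-(1 / 4 : ℝ)))) →
        (∀ τ ∈ Ioo 0 t, eLpNorm (v τ) ∞ volume ≤ ENNReal.ofReal (Lv * τ ^ (-(1 / 2 : ℝ)))) →
          ∀ x : EuclideanSpace ℝ (Fin 3),
            IntegrableOn (fun τ => ∫ y, oseenKernel (ν * (t - τ)) (x - y) (u τ y) (v τ y))
                (Ioo 0 t) volume ∧
              ‖∫ τ in Ioo 0 t, ∫ y, oseenKernel (ν * (t - τ)) (x - y) (u τ y) (v τ y)‖ ≤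
                cI * ν ^ (-(3 / 4 : ℝ)) * Ku * Lv * t ^ (-(1 / 2 : ℝ)))
    {C₀ δ : ℝ} (hC₀1 : 1 ≤ C₀) (hFC : CF ≤ C₀) (hδ0 : 0 ≤ δ)
    (hδ : (eLpNorm (u 0) 3 volume).toReal / ν + T ^ (3 / 4 : ℝ) * G₂ / ν ^ (5 / 4 : ℝ) ≤ δ)
    (hcIδ : cI * (2 * C₀ * δ) ≤ 1 / 4)
    (h6 : ∀ τ ∈ Ioc 0 T, eLpNorm (u τ) 6 volume ≤
      ENNReal.ofReal (2 * C₀ * δ * ν ^ (3 / 4 : ℝ) * τ ^ (-(1 / 4 : ℝ))))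
    {t : ℝ} (ht : t ∈ Ioc 0 T) (x : EuclideanSpace ℝ (Fin 3)) :
    ‖u t x‖ ≤ 2 * C₀ * δ * ν ^ (1 / 2 : ℝ) * t ^ (-(1 / 2 : ℝ)) := by
  set a : ℝ := (eLpNorm (u 0) 3 volume).toReal with ha
  have ha0 : 0 ≤ a := ENNReal.toReal_nonneg
  have hC₀0 : 0 < C₀ := by linarith
  have hforceT : ∀ {σ : ℝ}, 0 < σ → σ ≤ T →
      σ ^ (3 / 4 : ℝ) * G₂ / ν ^ (5 / 4 : ℝ) ≤ T ^ (3 / 4 : ℝ) * G₂ / ν ^ (5 / 4 : ℝ) := by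
    intro σ hσ0 hσT
    have hν54 : 0 < ν ^ (5 / 4 : ℝ) := Real.rpow_pos_of_pos hν _
    gcongr
  -- ### the weighted sup `ℓ`
  set S : Set ℝ := {r | ∃ s ∈ Ioc 0 T, ∃ y : EuclideanSpace ℝ (Fin 3), r = s ^ (1 / 2 : ℝ) * ‖u s y‖}
    with hSdef
  have hSne : S.Nonempty := ⟨_, t, ht, 0, rfl⟩
  have hSbdd : BddAbove S := by
    refine ⟨T ^ (1 / 2 : ℝ) * M, ?_⟩
    rintro r ⟨s, hs, y, rfl⟩
    have h1 : s ^ (1 / 2 : ℝ) ≤ T ^ (1 / 2 : ℝ) := Real.rpow_le_rpow hs.1.le hs.2 (by norm_num)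
    exact mul_le_mul h1 (hMb s ⟨hs.1.le, hs.2⟩ y) (norm_nonneg _) (Real.rpow_nonneg hT.le _)
  set ℓ : ℝ := sSup S with hℓ
  have hℓub : ∀ s ∈ Ioc 0 T, ∀ y, s ^ (1 / 2 : ℝ) * ‖u s y‖ ≤ ℓ :=
    fun s hs y => le_csSup hSbdd ⟨s, hs, y, rfl⟩
  have hℓ0 : 0 ≤ ℓ := le_trans (by have := ht.1; positivity) (hℓub t ht 0)
  have hIw : ∀ τ ∈ Ioc 0 T, ∀ y, ‖u τ y‖ ≤ ℓ * τ ^ (-(1 / 2 : ℝ)) := by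
    intro τ hτ y
    have hτ0 : 0 < τ := hτ.1
    have e1 : τ ^ (-(1 / 2 : ℝ)) * τ ^ (1 / 2 : ℝ) = 1 := by
      rw [← Real.rpow_add hτ0]; norm_num
    calc ‖u τ y‖ = τ ^ (-(1 / 2 : ℝ)) * (τ ^ (1 / 2 : ℝ) * ‖u τ y‖) := by
          rw [← mul_assoc, e1, one_mul]
      _ ≤ τ ^ (-(1 / 2 : ℝ)) * ℓ := mul_le_mul_of_nonneg_left (hℓub τ hτ y) (Real.rpow_nonneg hτ0.le _)
      _ = ℓ * τ ^ (-(1 / 2 : ℝ)) := mul_comm _ _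
  -- ### every element of `S` is `≤ √ν C₀ δ + ℓ/4`
  have hSle : ∀ r ∈ S, r ≤ ν ^ (1 / 2 : ℝ) * (C₀ * δ) + ℓ / 4 := by
    rintro r ⟨s, hs, y, rfl⟩
    have hs0 : 0 < s := hs.1
    have h6s : ∀ τ ∈ Ioo 0 s, eLpNorm (u τ) 6 volume ≤
        ENNReal.ofReal (2 * C₀ * δ * ν ^ (3 / 4 : ℝ) * τ ^ (-(1 / 4 : ℝ))) :=
      fun τ hτ => h6 τ ⟨hτ.1, hτ.2.le.trans hs.2⟩
    have hIs : ∀ τ ∈ Ioo 0 s, ∀ z, ‖u τ z‖ ≤ ℓ * τ ^ (-(1 / 2 : ℝ)) :=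
      fun τ hτ z => hIw τ ⟨hτ.1, hτ.2.le.trans hs.2⟩ z
    have hpt := norm_slice_le hν hT hcl hgc hG hgdiv hG₂ hg2 hE hM hMb (fun {ν' t' G' g'} => hFI)
      hcI (fun {ν'} => hKI) hs (Ku := 2 * C₀ * δ * ν ^ (3 / 4 : ℝ)) (Lu := ℓ) (by positivity) hℓ0
      h6s hIs y
    have hw0 : 0 ≤ s ^ (1 / 2 : ℝ) := Real.rpow_nonneg hs0.le _
    have h1 := mul_le_mul_of_nonneg_left hpt hw0
    rw [show cI * ν ^ (-(3 / 4 : ℝ)) * (2 * C₀ * δ * ν ^ (3 / 4 : ℝ)) * ℓ * s ^ (-(1 / 2 : ℝ)) =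
        cI * ν ^ (-(3 / 4 : ℝ)) * ((2 * C₀ * δ) * ν ^ (3 / 4 : ℝ)) * ℓ * s ^ (-(1 / 2 : ℝ)) by ring,
      alg_sup hν hs0] at h1
    -- bound the three terms
    have hν12 : 0 ≤ ν ^ (1 / 2 : ℝ) := Real.rpow_nonneg hν.le _
    have ha' : 0 ≤ a / ν := by positivity
    have hb' : 0 ≤ T ^ (3 / 4 : ℝ) * G₂ / ν ^ (5 / 4 : ℝ) := by positivity
    have i1 : a / ν ≤ C₀ * (a / ν) := le_mul_of_one_le_left ha' hC₀1
    have i2 : CF * (s ^ (3 / 4 : ℝ) * G₂ / ν ^ (5 / 4 : ℝ)) ≤ C₀ * (T ^ (3 / 4 : ℝ) * G₂ / ν ^ (5 / 4 : ℝ)) :=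
      (mul_le_mul_of_nonneg_left (hforceT hs0 hs.2) hCF).trans (mul_le_mul_of_nonneg_right hFC hb')
    have i3 : a / ν + CF * (s ^ (3 / 4 : ℝ) * G₂ / ν ^ (5 / 4 : ℝ)) ≤ C₀ * δ := by
      have := mul_le_mul_of_nonneg_left hδ hC₀0.le
      linarith
    have h2 : ν ^ (1 / 2 : ℝ) * (a / ν) + ν ^ (1 / 2 : ℝ) * (CF * (s ^ (3 / 4 : ℝ) * G₂ / ν ^ (5 / 4 : ℝ))) ≤
        ν ^ (1 / 2 : ℝ) * (C₀ * δ) := by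
      rw [← mul_add]; exact mul_le_mul_of_nonneg_left i3 hν12
    have h3 : cI * (2 * C₀ * δ) * ℓ ≤ ℓ / 4 := by
      have h := mul_le_mul_of_nonneg_right hcIδ hℓ0
      linarith
    linarith
  have hℓle : ℓ ≤ ν ^ (1 / 2 : ℝ) * (C₀ * δ) + ℓ / 4 := csSup_le hSne hSle
  have hℓfin : ℓ ≤ 2 * C₀ * δ * ν ^ (1 / 2 : ℝ) := by
    have hx : 0 ≤ ν ^ (1 / 2 : ℝ) * (C₀ * δ) := by positivity
    linarith
  calc ‖u t x‖ ≤ ℓ * t ^ (-(1 / 2 : ℝ)) := hIw t ht x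
    _ ≤ 2 * C₀ * δ * ν ^ (1 / 2 : ℝ) * t ^ (-(1 / 2 : ℝ)) :=
        mul_le_mul_of_nonneg_right hℓfin (Real.rpow_nonneg ht.1.le _)

/-- **Kato's a-priori bound for bounded classical solutions of the FORCED Navier–Stokes system on `ℝ³`
with scale-invariantly small data** (Kato 1984, Thm. 2 with (2.3)–(2.5), `m = 3`, `q = 6`, run as an
a-priori estimate; Lemarié-Rieusset 2016, Thm. 15.2). There are absolute `ε₀ > 0` and `K > 0` such
that: for `ν > 0`, `T > 0`, a classical solution `(u, p)` on `[0, T] × ℝ³` driven by a jointly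
continuous force `g` with bounded, weakly divergence-free slices of `L²` size `≤ G₂` (`G₂ ≥ 0`), of
finite energy, bounded velocity and with `t ↦ ‖u(t)‖_{L⁶}` continuous on `[0, T]`, IF the
dimensionless size `δ := ‖u(0)‖_{L³}/ν + T^{3/4} G₂/ν^{5/4}` is `≤ ε₀` THEN for every `t ∈ (0, T]`
`‖u(t)‖_{L⁶} ≤ K δ ν^{3/4} t^{-1/4}` and `|u(t, x)| ≤ K δ ν^{1/2} t^{-1/2}` for all `x`.
[cite: Kato1984, Thm. 2 with (2.3)–(2.5)] [cite: LemarieRieusset2016, Thm. 15.2 with Thm. 7.5 (proof, (7.40))] -/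
theorem kato_apriori_forced :
    ∃ ε₀ K : ℝ, 0 < ε₀ ∧ 0 < K ∧
      ∀ ⦃ν T M G G₂ : ℝ⦄ ⦃g u : ℝ → EuclideanSpace ℝ (Fin 3) → EuclideanSpace ℝ (Fin 3)⦄
        ⦃p : ℝ → EuclideanSpace ℝ (Fin 3) → ℝ⦄,
      0 < ν → 0 < T →
      IsClassicalNSSolutionOn (Icc 0 T) ν g u p → Continuous (uncurry g) →
      (∀ τ ∈ Icc 0 T, ∀ y, ‖g τ y‖ ≤ G) → (∀ τ ∈ Icc 0 T, IsWeaklyDivFree (g τ)) →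
      0 ≤ G₂ → (∀ τ ∈ Icc 0 T, eLpNorm (g τ) 2 volume ≤ ENNReal.ofReal G₂) →
      (∃ C : ℝ≥0∞, C < ⊤ ∧ ∀ t ∈ Icc 0 T, ∫⁻ x, ‖u t x‖ₑ ^ 2 ≤ C) →
      0 < M → (∀ t ∈ Icc 0 T, ∀ y, ‖u t y‖ ≤ M) →
      ContinuousOn (fun t => eLpNorm (u t) 6 volume) (Icc 0 T) →
      (eLpNorm (u 0) 3 volume).toReal / ν + T ^ (3 / 4 : ℝ) * G₂ / ν ^ (5 / 4 : ℝ) ≤ ε₀ →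
      ∀ t ∈ Ioc 0 T,
        eLpNorm (u t) 6 volume ≤ ENNReal.ofReal (K *
          ((eLpNorm (u 0) 3 volume).toReal / ν + T ^ (3 / 4 : ℝ) * G₂ / ν ^ (5 / 4 : ℝ)) *
            ν ^ (3 / 4 : ℝ) * t ^ (-(1 / 4 : ℝ))) ∧
        ∀ x, ‖u t x‖ ≤ K *
          ((eLpNorm (u 0) 3 volume).toReal / ν + T ^ (3 / 4 : ℝ) * G₂ / ν ^ (5 / 4 : ℝ)) *
            ν ^ (1 / 2 : ℝ) * t ^ (-(1 / 2 : ℝ)) := by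
  obtain ⟨C36, h36⟩ := exists_eLpNorm_six_heatExtension_le_of_three
  obtain ⟨CF6, hCF6, hF6⟩ := exists_eLpNorm_six_forceDuhamel_le
  obtain ⟨CF, hCF, hFI⟩ := exists_norm_forceDuhamel_le_of_eLpNorm_two
  obtain ⟨c₆, hc₆, hK6⟩ := exists_eLpNorm_six_oseenDuhamel_le (E := EuclideanSpace ℝ (Fin 3)) finrank_three
  obtain ⟨cI, hcI, hKI⟩ := exists_norm_oseenDuhamel_le (E := EuclideanSpace ℝ (Fin 3)) finrank_three
  -- ### the master constants
  set C₀ : ℝ := 1 + (C36 : ℝ) + CF6 + CF with hC₀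
  have hC36_0 : 0 ≤ (C36 : ℝ) := NNReal.zero_le_coe
  have hC₀1 : 1 ≤ C₀ := by rw [hC₀]; linarith
  have hC₀0 : 0 < C₀ := by linarith
  have h36C : (C36 : ℝ) ≤ C₀ := by rw [hC₀]; linarith
  have hF6C : CF6 ≤ C₀ := by rw [hC₀]; linarith
  have hFC : CF ≤ C₀ := by rw [hC₀]; linarith
  set ε₀ : ℝ := 1 / (16 * (c₆ + cI + 1) * C₀) with hε₀
  have hε₀0 : 0 < ε₀ := by positivity
  have hεkey : C₀ * ε₀ * (c₆ + cI + 1) = 1 / 16 := by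
    rw [hε₀]; field_simp
  have hc₆ε : 12 * c₆ * C₀ * ε₀ ≤ 1 := by
    have h1 : C₀ * ε₀ * c₆ ≤ 1 / 16 := by
      rw [← hεkey]; exact mul_le_mul_of_nonneg_left (by linarith) (by positivity)
    nlinarith
  have hcIε : cI * (2 * C₀ * ε₀) ≤ 1 / 4 := by
    have h1 : C₀ * ε₀ * cI ≤ 1 / 16 := by
      rw [← hεkey]; exact mul_le_mul_of_nonneg_left (by linarith) (by positivity)
    nlinarith
  refine ⟨ε₀, 2 * C₀, hε₀0, by positivity, ?_⟩
  intro ν T M G G₂ g u p hν hT hcl hgc hG hgdiv hG₂ hg2 hE hM hMb h6c hδ t ht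
  set δ : ℝ := (eLpNorm (u 0) 3 volume).toReal / ν + T ^ (3 / 4 : ℝ) * G₂ / ν ^ (5 / 4 : ℝ) with hδdef
  have hδ0 : 0 ≤ δ := by positivity
  have h6 : ∀ τ ∈ Ioc 0 T, eLpNorm (u τ) 6 volume ≤
      ENNReal.ofReal (2 * C₀ * δ * ν ^ (3 / 4 : ℝ) * τ ^ (-(1 / 4 : ℝ))) := fun τ hτ =>
    eLpNorm_six_apriori hν hT hcl hgc hG hgdiv hG₂ hg2 hE hM hMb h6c h36 hCF6 (fun {ν' t' G' g'} => hF6)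
      hc₆ (fun {ν'} => hK6) hC₀1 h36C hF6C hε₀0 hc₆ε hδ hτ
  have hcIδ : cI * (2 * C₀ * δ) ≤ 1 / 4 :=
    (mul_le_mul_of_nonneg_left (by nlinarith) hcI).trans hcIε
  exact ⟨h6 t ht, fun x => norm_apriori hν hT hcl hgc hG hgdiv hG₂ hg2 hE hM hMb hCF
    (fun {ν' t' G' g'} => hFI) hcI (fun {ν'} => hKI) hC₀1 hFC hδ0 le_rfl hcIδ h6 ht x⟩

end Main

end KatoAprioriForced

end Literature.Analysis.FluidPDE

end
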